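import Literature.Probability.RandomPlanarGeometry.LoewnerSlitLimit
import Literature.Probability.RandomPlanarGeometry.RestrictionDensityLoewner
import HarnessLib

/-!
# Loewner's slit theorem for the boundary path of an arc hull (`IsArcHull.exists_loewner_chain`)

G. F. Lawler, *Conformally Invariant Processes in the Plane*, AMS (2005), §4.1, Prop. 4.4 and
Remark 4.5: for a simple curve `γ` from a real point into `ℍ`, reparametrized by half-plane
capacity (`b(t) = hcap γ(0, t] = 2t`, `b` continuous and strictly increasing by Lemma 4.1),
the maps `g_t = g_{γ(0,t]}` satisfy Loewner's equation `ġ_t(z) = 2/(g_t(z) - U_t)` with the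
continuous driving function `U_t = g_t(γ(t))` of Lemma 4.2, for `z` off the curve, and up to
the time at which `z = γ(t₀)` is reached if `z` is on it. [LSW] (Lawler–Schramm–Werner,
*Conformal restriction: the chordal case* (2003), proof of Lemma 3.5, p. 13) apply this to the
closed boundary path `β[0, s]` of the hull `E_δ`, `β(0), β(s) ∈ ℝ`, so that the terminal hull
is `E_δ` itself (`g_s = g_{E_δ}`).

This file completes the tree's function-theoretic proof (no Brownian motion) of exactly this
statement, the named fact `Literature.Probability.RandomPlanarGeometry.IsArcHull.exists_loewner_chain`
of `RestrictionDensityLoewner`, from `LoewnerSlitMaps` (the maps `g_u`, tip values `U_u`, their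
uniform continuity, `b`) and `LoewnerSlitLimit` (`g_u → g_A`, `b(u) → hcap(A)`, collapse of the
enclosed region):

* `SlitArcData.capFn`, `…sigmaR`, `…tipFn`, `…driving` — `b` on `[0, 1]` (continuous, strictly
  increasing, `b(0) = 0`, `b(1) = hcap(A)`), the capacity reparametrization `σ = b⁻¹(2·)` on
  `[0, S]`, `S = hcap(A)/2`, the tip values on `[0, 1]` (continuous, `U_0 = γ(0)`), and the
  driving function `W_t = U_{σ(t)}`;
* `SlitArcData.isSolution_orbit` — **Loewner's equation** (Prop. 4.4): for `z ∈ ℍ` off the slits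
  `γ[0, σ(t)]`, `t < S'`, the orbit `t ↦ g_{σ(t)}(z)` solves `ġ = 2/(g - W_t)` on `[0, S')` in the
  sense of the tree's `Loewner.IsSolution` (right derivative from Prop. 3.46 for the quotient maps
  `g_{σ(t),σ(t+ε)}` of capacity `2ε` and shrinking radius, upgraded by Lawler's Lemma 4.3 /
  Mathlib's `eq_of_has_deriv_right_eq`);
* `SlitArcData.swallowingTime_eq_…` — the swallowing times: `T_z > S` off `A`, `T_{γ(v)} = b(v)/2`
  on the arc, `T_z = S` for the enclosed points `z ∈ int A`; hence
  `SlitArcData.hull_driving_eq` / `hull_driving_termTime` — **`K_t = γ(0, σ(t)]` for `t < S` and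
  `K_S = A ∩ ℍ`**;
* `IsArcHull.exists_loewner_chain_holds` — **the named fact**, and
  `IsPlusHull.exists_isLSWGenerated_lswConverges_holds` — **[LSW] Lemma 3.5, density of `𝒜₀` in
  `𝒬₊`**, now a theorem (`RestrictionDensityLoewner.…_of_loewner`).

## References

* G. F. Lawler, *Conformally Invariant Processes in the Plane* (2005), §4.1: Lemmas 4.1–4.3,
  Prop. 4.4, Remark 4.5. [Lawler2005]
* G. F. Lawler, O. Schramm, W. Werner, *Conformal restriction: the chordal case* (2003), proof
  of Lemma 3.5, p. 13. [LawlerSchrammWerner2003Restriction]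
-/

noncomputable section

open Set Filter Topology Metric Bornology Complex Function
open UpperHalfPlane (upperHalfPlaneSet isOpen_upperHalfPlaneSet)
open Literature.Analysis.Complex
open scoped Real NNReal

namespace Literature.Probability.RandomPlanarGeometry

namespace SlitArcData

variable {A : Set ℂ} {γ : ℝ → ℂ}

/-! ### The capacity function `b` on `[0, 1]` -/

/-- **`b(u) = hcap γ[0, u]`** on `[0, 1]` (`b(0) = 0`, `b(1) = hcap(A)`; junk outside).
[cite: Lawler2005, §4.1 Remark 4.5] -/
def capFn (h : SlitArcData A γ) (u : ℝ) : ℝ :=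
  if hu : u ∈ Ioo (0 : ℝ) 1 then hcap (slit γ u) (h.slitMap hu) else if u ≤ 0 then 0 else hcap A h.hydroMapA

/-- `b(u)` for `0 < u < 1`. [folklore] -/
theorem capFn_of_mem (h : SlitArcData A γ) {u : ℝ} (hu : u ∈ Ioo (0 : ℝ) 1) :
    h.capFn u = hcap (slit γ u) (h.slitMap hu) := by
  rw [capFn, dif_pos hu]

/-- `b(0) = 0`. [folklore] -/
@[simp] theorem capFn_zero (h : SlitArcData A γ) : h.capFn 0 = 0 := by
  rw [capFn, dif_neg (by simp), if_pos le_rfl]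

/-- `b(1) = hcap(A)`. [folklore] -/
@[simp] theorem capFn_one (h : SlitArcData A γ) : h.capFn 1 = hcap A h.hydroMapA := by
  rw [capFn, dif_neg (by simp), if_neg (by norm_num)]

/-- **`b` is strictly increasing on `[0, 1]`.** [cite: Lawler2005, §4.1 Remark 4.5] -/
theorem capFn_strictMonoOn (h : SlitArcData A γ) : StrictMonoOn h.capFn (Icc 0 1) := by
  intro u hu u' hu' huu'
  rcases hu.1.lt_or_eq with hu0 | hu0
  · have hu1 : u < 1 := huu'.trans_le hu'.2
    rw [h.capFn_of_mem ⟨hu0, hu1⟩]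
    rcases hu'.2.lt_or_eq with hu'1 | hu'1
    · rw [h.capFn_of_mem ⟨hu0.trans huu', hu'1⟩]
      exact h.hcap_slit_lt_hcap_slit _ _ huu'
    · rw [hu'1, capFn_one]
      exact h.hcap_slit_lt_hcap_hull _
  · rw [← hu0, capFn_zero]
    rcases hu'.2.lt_or_eq with hu'1 | hu'1
    · rw [h.capFn_of_mem ⟨hu0 ▸ huu', hu'1⟩]
      exact h.hcap_slit_pos _
    · rw [hu'1, capFn_one]
      exact h.hcap_hull_pos

/-- **`b` is continuous on `[0, 1]`.** [cite: Lawler2005, §4.1 Remark 4.5] -/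
theorem capFn_continuousOn (h : SlitArcData A γ) : ContinuousOn h.capFn (Icc 0 1) := by
  intro u hu
  rw [Metric.continuousWithinAt_iff]
  intro ε hε
  have hε2 : 0 < ε / 2 := half_pos hε
  rcases hu.1.lt_or_eq with hu0 | hu0
  · rcases hu.2.lt_or_eq with hu1 | hu1
    · -- interior point
      obtain ⟨θ, hθ, hB⟩ := h.hcap_slit_sub_mem_Icc hε2
      refine ⟨min θ (min u (1 - u)), lt_min hθ (lt_min hu0 (by linarith)), fun u' hu' hdist ↦ ?_⟩
      rw [Real.dist_eq] at hdist
      have h1 : |u' - u| < θ := hdist.trans_le (min_le_left _ _)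
      have h2 : |u' - u| < min u (1 - u) := hdist.trans_le (min_le_right _ _)
      have hu'0 : 0 < u' := by
        have := (abs_lt.1 (h2.trans_le (min_le_left _ _))).1; linarith
      have hu'1 : u' < 1 := by
        have := (abs_lt.1 (h2.trans_le (min_le_right _ _))).2; linarith
      have hum : u ∈ Ioo (0 : ℝ) 1 := ⟨hu0, hu1⟩
      have hu'm : u' ∈ Ioo (0 : ℝ) 1 := ⟨hu'0, hu'1⟩
      rw [h.capFn_of_mem hum, h.capFn_of_mem hu'm, Real.dist_eq]
      rcases le_total u u' with hle | hle
      · have := hB hum hu'm hle (by linarith [(abs_lt.1 h1).2])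
        rw [abs_of_nonneg this.1]; linarith [this.2]
      · have := hB hu'm hum hle (by linarith [(abs_lt.1 h1).1])
        rw [abs_sub_comm, abs_of_nonneg this.1]; linarith [this.2]
    · -- `u = 1`
      subst hu1
      obtain ⟨θ, hθ, hB⟩ := h.hcap_hull_sub_hcap_slit_mem_Icc hε2
      refine ⟨min θ 1, lt_min hθ one_pos, fun u' hu' hdist ↦ ?_⟩
      rw [Real.dist_eq] at hdist
      rcases hu'.2.lt_or_eq with hu'1 | hu'1
      · have hu'0 : 0 < u' := by
          have := (abs_lt.1 (hdist.trans_le (min_le_right _ _))).1; linarith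
        have hu'm : u' ∈ Ioo (0 : ℝ) 1 := ⟨hu'0, hu'1⟩
        have := hB hu'm (by
          have := (abs_lt.1 (hdist.trans_le (min_le_left _ _))).1; linarith)
        rw [h.capFn_of_mem hu'm, capFn_one, Real.dist_eq, abs_sub_comm, abs_of_nonneg this.1]
        linarith [this.2]
      · rw [hu'1, dist_self]; exact hε
  · -- `u = 0`
    subst hu0
    obtain ⟨θ, hθ, hB⟩ := h.hcap_slit_le_of_lt hε2
    refine ⟨min θ 1, lt_min hθ one_pos, fun u' hu' hdist ↦ ?_⟩
    rw [Real.dist_eq, sub_zero] at hdist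
    rcases hu'.1.lt_or_eq with hu'0 | hu'0
    · have hu'1 : u' < 1 := (le_abs_self _).trans_lt (hdist.trans_le (min_le_right _ _))
      have hu'm : u' ∈ Ioo (0 : ℝ) 1 := ⟨hu'0, hu'1⟩
      have h1 := hB hu'm ((le_abs_self _).trans_lt (hdist.trans_le (min_le_left _ _)))
      have h2 := h.hcap_slit_nonneg hu'm
      rw [h.capFn_of_mem hu'm, capFn_zero, Real.dist_eq, sub_zero, abs_of_nonneg h2]
      linarith
    · rw [← hu'0, dist_self]; exact hε

/-- `b` maps `[0, 1]` onto `[0, hcap(A)]`. [folklore] -/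
theorem capFn_surjOn (h : SlitArcData A γ) : SurjOn h.capFn (Icc 0 1) (Icc 0 (hcap A h.hydroMapA)) := by
  have := intermediate_value_Icc zero_le_one h.capFn_continuousOn
  rwa [capFn_zero, capFn_one] at this

/-- `b` maps `[0, 1]` into `[0, hcap(A)]`. [folklore] -/
theorem capFn_mem_Icc (h : SlitArcData A γ) {u : ℝ} (hu : u ∈ Icc (0 : ℝ) 1) :
    h.capFn u ∈ Icc 0 (hcap A h.hydroMapA) := by
  have hm := h.capFn_strictMonoOn.monotoneOn
  refine ⟨?_, ?_⟩
  · have := hm ⟨le_rfl, zero_le_one⟩ hu hu.1; rwa [capFn_zero] at this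
  · have := hm hu ⟨zero_le_one, le_rfl⟩ hu.2; rwa [capFn_one] at this

/-! ### The capacity reparametrization `σ` -/

/-- Half the capacity of `A`: the **terminal time** `S = hcap(A)/2`. [cite: LawlerSchrammWerner2003Restriction, proof of Lemma 3.5 (p. 13, a(β[0,t]) = 2t)] -/
def termTimeR (h : SlitArcData A γ) : ℝ := hcap A h.hydroMapA / 2

/-- `S > 0`. [folklore] -/
theorem termTimeR_pos (h : SlitArcData A γ) : 0 < h.termTimeR := by
  unfold termTimeR; have := h.hcap_hull_pos; positivity

/-- **The capacity reparametrization** `σ(t) = b⁻¹(2t)` on `[0, S]` (clamped outside). [cite: Lawler2005, §4.1 Remark 4.5] -/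
def sigmaR (h : SlitArcData A γ) (t : ℝ) : ℝ :=
  invFunOn h.capFn (Icc 0 1) (2 * max 0 (min t h.termTimeR))

/-- The clamped argument lies in `[0, hcap(A)]`. [folklore] -/
theorem two_mul_clamp_mem (h : SlitArcData A γ) (t : ℝ) :
    2 * max 0 (min t h.termTimeR) ∈ Icc 0 (hcap A h.hydroMapA) := by
  refine ⟨by positivity, ?_⟩
  have : max 0 (min t h.termTimeR) ≤ h.termTimeR :=
    max_le h.termTimeR_pos.le (min_le_right _ _)
  have h2 : h.termTimeR = hcap A h.hydroMapA / 2 := rfl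
  linarith

/-- `σ(t) ∈ [0, 1]`. [folklore] -/
theorem sigmaR_mem (h : SlitArcData A γ) (t : ℝ) : h.sigmaR t ∈ Icc (0 : ℝ) 1 :=
  invFunOn_mem (h.capFn_surjOn (h.two_mul_clamp_mem t))

/-- `b(σ(t)) = 2t` for `t ∈ [0, S]`. [folklore] -/
theorem capFn_sigmaR (h : SlitArcData A γ) {t : ℝ} (ht : t ∈ Icc 0 h.termTimeR) :
    h.capFn (h.sigmaR t) = 2 * t := by
  have := invFunOn_eq (h.capFn_surjOn (h.two_mul_clamp_mem t))
  rw [sigmaR, this, min_eq_left ht.2, max_eq_right ht.1]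

/-- `σ(b(v)/2) = v` for `v ∈ [0, 1]`. [folklore] -/
theorem sigmaR_capFn_div_two (h : SlitArcData A γ) {v : ℝ} (hv : v ∈ Icc (0 : ℝ) 1) :
    h.sigmaR (h.capFn v / 2) = v := by
  have hb := h.capFn_mem_Icc hv
  have ht : h.capFn v / 2 ∈ Icc 0 h.termTimeR := ⟨by linarith [hb.1], by unfold termTimeR; linarith [hb.2]⟩
  have h1 := h.capFn_sigmaR ht
  rw [mul_div_cancel₀ _ (two_ne_zero)] at h1
  exact h.capFn_strictMonoOn.injOn (h.sigmaR_mem _) hv h1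

/-- `σ(0) = 0`. [folklore] -/
@[simp] theorem sigmaR_zero (h : SlitArcData A γ) : h.sigmaR 0 = 0 := by
  have := h.sigmaR_capFn_div_two ⟨le_rfl, zero_le_one⟩
  rwa [capFn_zero, zero_div] at this

/-- `σ(S) = 1`. [folklore] -/
@[simp] theorem sigmaR_termTimeR (h : SlitArcData A γ) : h.sigmaR h.termTimeR = 1 := by
  have := h.sigmaR_capFn_div_two ⟨zero_le_one, le_rfl⟩
  rwa [capFn_one] at this

/-- **`σ` is strictly increasing on `[0, S]`.** [folklore] -/
theorem sigmaR_strictMonoOn (h : SlitArcData A γ) : StrictMonoOn h.sigmaR (Icc 0 h.termTimeR) := by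
  intro t ht t' ht' htt'
  by_contra hle
  rw [not_lt] at hle
  have hm := h.capFn_strictMonoOn.monotoneOn (h.sigmaR_mem t') (h.sigmaR_mem t) hle
  rw [h.capFn_sigmaR ht, h.capFn_sigmaR ht'] at hm
  linarith

/-- `σ(t) < 1` for `t < S`, `σ(t) > 0` for `t > 0` (within `[0, S]`). [folklore] -/
theorem sigmaR_mem_Ioo (h : SlitArcData A γ) {t : ℝ} (ht : t ∈ Ioo 0 h.termTimeR) :
    h.sigmaR t ∈ Ioo (0 : ℝ) 1 := by
  have h0 := h.sigmaR_strictMonoOn ⟨le_rfl, h.termTimeR_pos.le⟩ ⟨ht.1.le, ht.2.le⟩ ht.1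
  have h1 := h.sigmaR_strictMonoOn ⟨ht.1.le, ht.2.le⟩ ⟨h.termTimeR_pos.le, le_rfl⟩ ht.2
  rw [sigmaR_zero] at h0; rw [sigmaR_termTimeR] at h1
  exact ⟨h0, h1⟩

/-- `σ(t) < 1` for `0 ≤ t < S`. [folklore] -/
theorem sigmaR_lt_one (h : SlitArcData A γ) {t : ℝ} (ht0 : 0 ≤ t) (ht : t < h.termTimeR) : h.sigmaR t < 1 := by
  have h1 := h.sigmaR_strictMonoOn ⟨ht0, ht.le⟩ ⟨h.termTimeR_pos.le, le_rfl⟩ ht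
  rwa [sigmaR_termTimeR] at h1

/-- **`σ` is continuous on `[0, S]`** (a strictly monotone function with interval image). [folklore] -/
theorem sigmaR_continuousOn (h : SlitArcData A γ) : ContinuousOn h.sigmaR (Icc 0 h.termTimeR) := by
  intro t ht
  have hS := h.termTimeR_pos
  -- right and left continuity separately
  have hright : ContinuousWithinAt h.sigmaR (Icc 0 h.termTimeR ∩ Ici t) t := by
    rcases ht.2.lt_or_eq with htS | htS
    · have hs : Icc t h.termTimeR ∈ 𝓝[≥] t := Icc_mem_nhdsGE htS
      have hmono : StrictMonoOn h.sigmaR (Icc t h.termTimeR) :=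
        h.sigmaR_strictMonoOn.mono (Icc_subset_Icc ht.1 le_rfl)
      have hc := hmono.continuousWithinAt_right_of_exists_between hs fun b hb ↦ by
        set b' : ℝ := min b 1 with hb'
        have hσt1 : h.sigmaR t < 1 := h.sigmaR_lt_one ht.1 htS
        have hb'σ : h.sigmaR t < b' := lt_min hb hσt1
        have hb'm : b' ∈ Icc (0 : ℝ) 1 := ⟨(h.sigmaR_mem t).1.trans hb'σ.le, min_le_right _ _⟩
        refine ⟨h.capFn b' / 2, ⟨?_, ?_⟩, ?_⟩
        · have := h.capFn_strictMonoOn.monotoneOn (h.sigmaR_mem t) hb'm hb'σ.le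
          rw [h.capFn_sigmaR ht] at this; linarith
        · have := (h.capFn_mem_Icc hb'm).2; unfold termTimeR; linarith
        · rw [h.sigmaR_capFn_div_two hb'm]
          exact ⟨hb'σ, min_le_left _ _⟩
      exact hc.mono fun s hs' ↦ hs'.2
    · rw [htS]
      have : Icc 0 h.termTimeR ∩ Ici h.termTimeR = {h.termTimeR} := by
        ext s; constructor
        · rintro ⟨hs1, hs2⟩; exact le_antisymm hs1.2 hs2
        · rintro rfl; exact ⟨⟨hS.le, le_rfl⟩, self_mem_Ici⟩
      rw [this]; exact continuousWithinAt_singleton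
  have hleft : ContinuousWithinAt h.sigmaR (Icc 0 h.termTimeR ∩ Iic t) t := by
    rcases ht.1.lt_or_eq with ht0 | ht0
    · have hs : Icc 0 t ∈ 𝓝[≤] t := Icc_mem_nhdsLE ht0
      have hmono : StrictMonoOn h.sigmaR (Icc 0 t) :=
        h.sigmaR_strictMonoOn.mono (Icc_subset_Icc le_rfl ht.2)
      have hc := hmono.continuousWithinAt_left_of_exists_between hs fun b hb ↦ by
        set b' : ℝ := max b 0 with hb'
        have hσt0 : 0 < h.sigmaR t := by
          have := h.sigmaR_strictMonoOn ⟨le_rfl, hS.le⟩ ht ht0; rwa [sigmaR_zero] at this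
        have hb'σ : b' < h.sigmaR t := max_lt hb hσt0
        have hb'm : b' ∈ Icc (0 : ℝ) 1 := ⟨le_max_right _ _, hb'σ.le.trans (h.sigmaR_mem t).2⟩
        refine ⟨h.capFn b' / 2, ⟨?_, ?_⟩, ?_⟩
        · linarith [(h.capFn_mem_Icc hb'm).1]
        · have := h.capFn_strictMonoOn.monotoneOn hb'm (h.sigmaR_mem t) hb'σ.le
          rw [h.capFn_sigmaR ht] at this; linarith
        · rw [h.sigmaR_capFn_div_two hb'm]
          exact ⟨le_max_left _ _, hb'σ⟩
      exact hc.mono fun s hs' ↦ hs'.2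
    · rw [← ht0]
      have : Icc 0 h.termTimeR ∩ Iic 0 = {0} := by
        ext s; constructor
        · rintro ⟨hs1, hs2⟩; exact le_antisymm hs2 hs1.1
        · rintro rfl; exact ⟨⟨le_rfl, hS.le⟩, self_mem_Iic⟩
      rw [this]; exact continuousWithinAt_singleton
  have := hleft.union hright
  rwa [← inter_union_distrib_left, Iic_union_Ici, inter_univ] at this

/-! ### The tip values on `[0, 1]` and the driving function -/

/-- The tip values on `(0, 1)` as a total function (junk `0` outside). [folklore] -/
def tipAux (h : SlitArcData A γ) (u : ℝ) : ℝ := if hu : u ∈ Ioo (0 : ℝ) 1 then h.tipVal hu else 0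

/-- **The terminal tip value `U_1 = lim_{u ↑ 1} U_u`.** [cite: Lawler2005, §4.1 Lemma 4.2] -/
def tipValOne (h : SlitArcData A γ) : ℝ := limUnder (𝓝[<] (1 : ℝ)) h.tipAux

/-- `U_u → U_1` as `u ↑ 1` (Cauchy, by the uniform continuity of `u ↦ U_u`). [cite: Lawler2005, §4.1 Lemma 4.2] -/
theorem tendsto_tipAux_one (h : SlitArcData A γ) : Tendsto h.tipAux (𝓝[<] (1 : ℝ)) (𝓝 h.tipValOne) := by
  have hC : Cauchy (map h.tipAux (𝓝[<] (1 : ℝ))) := by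
    rw [Metric.cauchy_iff]
    refine ⟨inferInstance, fun ε hε ↦ ?_⟩
    obtain ⟨θ, hθ, hB⟩ := h.abs_tipVal_sub_tipVal_le (half_pos hε)
    have hmem : Ioo (1 - min θ 1) 1 ∈ 𝓝[<] (1 : ℝ) := Ioo_mem_nhdsLT (by
      have := min_le_right θ 1; have := lt_min hθ one_pos; linarith)
    refine ⟨h.tipAux '' Ioo (1 - min θ 1) 1, image_mem_map hmem, ?_⟩
    rintro _ ⟨u, hu, rfl⟩ _ ⟨u', hu', rfl⟩
    have hθ1 := min_le_left θ 1
    have h01 : 0 ≤ 1 - min θ 1 := by linarith [min_le_right θ 1]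
    have hum : u ∈ Ioo (0 : ℝ) 1 := ⟨h01.trans_lt hu.1, hu.2⟩
    have hu'm : u' ∈ Ioo (0 : ℝ) 1 := ⟨h01.trans_lt hu'.1, hu'.2⟩
    rw [tipAux, tipAux, dif_pos hum, dif_pos hu'm, Real.dist_eq]
    rcases le_total u u' with hle | hle
    · have := hB hum hu'm hle (by linarith [hu.1, hu'.2])
      rw [abs_sub_comm]; linarith
    · have := hB hu'm hum hle (by linarith [hu'.1, hu.2])
      linarith
  obtain ⟨L, hL⟩ := CompleteSpace.complete hC
  have hL' : Tendsto h.tipAux (𝓝[<] (1 : ℝ)) (𝓝 L) := hL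
  rw [tipValOne, hL'.limUnder_eq]
  exact hL'

/-- **The tip values `U_u` on `[0, 1]`**: `U_0 = γ(0)`, `U_1 = lim_{u ↑ 1} U_u`. [cite: Lawler2005, §4.1 Lemma 4.2] -/
def tipFn (h : SlitArcData A γ) (u : ℝ) : ℝ :=
  if hu : u ∈ Ioo (0 : ℝ) 1 then h.tipVal hu else if u ≤ 0 then (γ 0).re else h.tipValOne

/-- `U_u` for `0 < u < 1`. [folklore] -/
theorem tipFn_of_mem (h : SlitArcData A γ) {u : ℝ} (hu : u ∈ Ioo (0 : ℝ) 1) : h.tipFn u = h.tipVal hu := by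
  rw [tipFn, dif_pos hu]

/-- `U_0 = γ(0)`. [folklore] -/
@[simp] theorem tipFn_zero (h : SlitArcData A γ) : h.tipFn 0 = (γ 0).re := by
  rw [tipFn, dif_neg (by simp), if_pos le_rfl]

/-- `U_1`. [folklore] -/
@[simp] theorem tipFn_one (h : SlitArcData A γ) : h.tipFn 1 = h.tipValOne := by
  rw [tipFn, dif_neg (by simp), if_neg (by norm_num)]

/-- **`u ↦ U_u` is continuous on `[0, 1]`** (Lawler (2005), Lemma 4.2). [cite: Lawler2005, §4.1 Lemma 4.2] -/
theorem tipFn_continuousOn (h : SlitArcData A γ) : ContinuousOn h.tipFn (Icc 0 1) := by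
  intro u hu
  rw [Metric.continuousWithinAt_iff]
  intro ε hε
  have hε2 : 0 < ε / 2 := half_pos hε
  rcases hu.1.lt_or_eq with hu0 | hu0
  · rcases hu.2.lt_or_eq with hu1 | hu1
    · obtain ⟨θ, hθ, hB⟩ := h.abs_tipVal_sub_tipVal_le hε2
      refine ⟨min θ (min u (1 - u)), lt_min hθ (lt_min hu0 (by linarith)), fun u' hu' hdist ↦ ?_⟩
      rw [Real.dist_eq] at hdist
      have h1 : |u' - u| < θ := hdist.trans_le (min_le_left _ _)
      have h2 : |u' - u| < min u (1 - u) := hdist.trans_le (min_le_right _ _)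
      have hu'0 : 0 < u' := by
        have := (abs_lt.1 (h2.trans_le (min_le_left _ _))).1; linarith
      have hu'1 : u' < 1 := by
        have := (abs_lt.1 (h2.trans_le (min_le_right _ _))).2; linarith
      have hum : u ∈ Ioo (0 : ℝ) 1 := ⟨hu0, hu1⟩
      have hu'm : u' ∈ Ioo (0 : ℝ) 1 := ⟨hu'0, hu'1⟩
      rw [h.tipFn_of_mem hum, h.tipFn_of_mem hu'm, Real.dist_eq]
      rcases le_total u u' with hle | hle
      · have := hB hum hu'm hle (by linarith [(abs_lt.1 h1).2])
        linarith
      · have := hB hu'm hum hle (by linarith [(abs_lt.1 h1).1])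
        rw [abs_sub_comm]; linarith
    · subst hu1
      have ht := h.tendsto_tipAux_one
      rw [Metric.tendsto_nhdsWithin_nhds] at ht
      obtain ⟨δ, hδ, hB⟩ := ht ε hε
      refine ⟨min δ 1, lt_min hδ one_pos, fun u' hu' hdist ↦ ?_⟩
      rcases hu'.2.lt_or_eq with hu'1 | hu'1
      · have hu'0 : 0 < u' := by
          rw [Real.dist_eq] at hdist
          have := (abs_lt.1 (hdist.trans_le (min_le_right _ _))).1; linarith
        have hu'm : u' ∈ Ioo (0 : ℝ) 1 := ⟨hu'0, hu'1⟩
        have := hB hu'1 (hdist.trans_le (min_le_left _ _))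
        rw [tipAux, dif_pos hu'm] at this
        rwa [h.tipFn_of_mem hu'm, tipFn_one]
      · rw [hu'1, dist_self]; exact hε
  · subst hu0
    obtain ⟨θ, hθ, hB⟩ := h.norm_tipVal_sub_apply_zero_le hε2
    refine ⟨min θ 1, lt_min hθ one_pos, fun u' hu' hdist ↦ ?_⟩
    rw [Real.dist_eq, sub_zero] at hdist
    rcases hu'.1.lt_or_eq with hu'0 | hu'0
    · have hu'1 : u' < 1 := (le_abs_self _).trans_lt (hdist.trans_le (min_le_right _ _))
      have hu'm : u' ∈ Ioo (0 : ℝ) 1 := ⟨hu'0, hu'1⟩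
      have h1 := hB hu'm ((le_abs_self _).trans_lt (hdist.trans_le (min_le_left _ _)))
      rw [h.tipFn_of_mem hu'm, tipFn_zero, Real.dist_eq]
      have : ((h.tipVal hu'm : ℝ) : ℂ) - γ 0 = (((h.tipVal hu'm - (γ 0).re : ℝ)) : ℂ) := by
        rw [h.apply_zero_eq]; push_cast; ring_nf
        simp
      rw [this, norm_real, Real.norm_eq_abs] at h1
      linarith
    · rw [← hu'0, dist_self]; exact hε

/-- The terminal time as a nonnegative real. [folklore] -/
def termTime (h : SlitArcData A γ) : ℝ≥0 := ⟨h.termTimeR, h.termTimeR_pos.le⟩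

/-- `(S : ℝ) = hcap(A)/2`. [folklore] -/
@[simp] theorem coe_termTime (h : SlitArcData A γ) : (h.termTime : ℝ) = h.termTimeR := rfl

/-- `S > 0` in `ℝ≥0`. [folklore] -/
theorem termTime_pos (h : SlitArcData A γ) : 0 < h.termTime := by
  rw [← NNReal.coe_pos, coe_termTime]; exact h.termTimeR_pos

/-- **The driving function `W_t = U_{σ(t)}`** (constant after `S`). [cite: Lawler2005, §4.1 Prop. 4.4] -/
def driving (h : SlitArcData A γ) : ℝ≥0 → ℝ := fun t ↦ h.tipFn (h.sigmaR t)

/-- `σ` as a function on `ℝ≥0`, for the statement of the slit theorem. [folklore] -/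
def sigma (h : SlitArcData A γ) : ℝ≥0 → ℝ := fun t ↦ h.sigmaR t

/-- `σ` is constant `= 1` after `S` (clamping). [folklore] -/
theorem sigmaR_of_le (h : SlitArcData A γ) {t : ℝ} (ht : h.termTimeR ≤ t) : h.sigmaR t = 1 := by
  rw [← h.sigmaR_termTimeR, sigmaR, sigmaR, min_eq_right ht, min_self]

/-- `σ` is constant `= 0` before `0` (clamping). [folklore] -/
theorem sigmaR_of_nonpos (h : SlitArcData A γ) {t : ℝ} (ht : t ≤ 0) : h.sigmaR t = 0 := by
  rw [← h.sigmaR_zero, sigmaR, sigmaR]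
  congr 2
  rw [max_eq_left ((min_le_left _ _).trans ht), min_eq_left h.termTimeR_pos.le, max_self]

/-- `σ` is continuous on all of `ℝ` (clamped). [folklore] -/
theorem continuous_sigmaR (h : SlitArcData A γ) : Continuous h.sigmaR := by
  have hproj : Continuous fun t : ℝ ↦ max 0 (min t h.termTimeR) := by fun_prop
  have heq : h.sigmaR = h.sigmaR ∘ fun t : ℝ ↦ max 0 (min t h.termTimeR) := by
    ext t
    simp only [comp_apply, sigmaR]
    congr 2
    have h1 : 0 ≤ max 0 (min t h.termTimeR) := le_max_left _ _
    have h2 : max 0 (min t h.termTimeR) ≤ h.termTimeR := max_le h.termTimeR_pos.le (min_le_right _ _)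
    rw [min_eq_left h2, max_eq_right h1]
  rw [heq]
  exact h.sigmaR_continuousOn.comp_continuous hproj fun _ ↦
    ⟨le_max_left _ _, max_le h.termTimeR_pos.le (min_le_right _ _)⟩

/-- **The driving function is continuous.** [cite: Lawler2005, §4.1 Lemma 4.2] -/
theorem continuous_driving (h : SlitArcData A γ) : Continuous h.driving :=
  h.tipFn_continuousOn.comp_continuous (h.continuous_sigmaR.comp NNReal.continuous_coe)
    fun _ ↦ h.sigmaR_mem _

/-- **`W_0 = γ(0)`.** [cite: Lawler2005, §4.1 (U_0 = γ(0))] -/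
theorem driving_zero (h : SlitArcData A γ) : (h.driving 0 : ℂ) = γ 0 := by
  simp only [driving, NNReal.coe_zero, sigmaR_zero, tipFn_zero]
  exact h.apply_zero_eq.symm

/-! ### The maps `G_u` and the orbits `t ↦ g_{σ(t)}(z)` -/

/-- The maps on `[0, 1]` as a total function: `G_0 = id`, `G_u = g_u` (`0 < u < 1`), `G_1 = g_A`. [folklore] -/
def mapFn (h : SlitArcData A γ) (u : ℝ) (z : ℂ) : ℂ :=
  if hu : u ∈ Ioo (0 : ℝ) 1 then h.slitMap hu z else if u ≤ 0 then z else h.hydroMapA z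

/-- `G_u = g_u` for `0 < u < 1`. [folklore] -/
theorem mapFn_of_mem (h : SlitArcData A γ) {u : ℝ} (hu : u ∈ Ioo (0 : ℝ) 1) (z : ℂ) :
    h.mapFn u z = h.slitMap hu z := by rw [mapFn, dif_pos hu]

/-- `G_u = id` for `u ≤ 0`. [folklore] -/
theorem mapFn_of_nonpos (h : SlitArcData A γ) {u : ℝ} (hu : u ≤ 0) (z : ℂ) : h.mapFn u z = z := by
  rw [mapFn, dif_neg (fun h' ↦ by linarith [h'.1]), if_pos hu]

/-- `G_u = g_A` for `u ≥ 1`. [folklore] -/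
theorem mapFn_of_one_le (h : SlitArcData A γ) {u : ℝ} (hu : 1 ≤ u) (z : ℂ) : h.mapFn u z = h.hydroMapA z := by
  rw [mapFn, dif_neg (fun h' ↦ by linarith [h'.2]), if_neg (by linarith)]

/-- **The orbit `t ↦ g_{σ(t)}(z)`** (`= z` for `t ≤ 0`, `= g_A(z)` for `t ≥ S`). [cite: Lawler2005, §4.1 Prop. 4.4] -/
def orbit (h : SlitArcData A γ) (z : ℂ) (t : ℝ) : ℂ := h.mapFn (h.sigmaR t) z

/-- The orbit before time `0`. [folklore] -/
theorem orbit_of_nonpos (h : SlitArcData A γ) (z : ℂ) {t : ℝ} (ht : t ≤ 0) : h.orbit z t = z := by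
  rw [orbit, h.sigmaR_of_nonpos ht, h.mapFn_of_nonpos le_rfl]

/-- The orbit at positive times before `S`. [folklore] -/
theorem orbit_of_mem (h : SlitArcData A γ) (z : ℂ) {t : ℝ} (ht : t ∈ Ioo 0 h.termTimeR) :
    h.orbit z t = h.slitMap (h.sigmaR_mem_Ioo ht) z := by
  rw [orbit, h.mapFn_of_mem (h.sigmaR_mem_Ioo ht)]

/-- The orbit from time `S` on. [folklore] -/
theorem orbit_of_le (h : SlitArcData A γ) (z : ℂ) {t : ℝ} (ht : h.termTimeR ≤ t) : h.orbit z t = h.hydroMapA z := by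
  rw [orbit, h.sigmaR_of_le ht, h.mapFn_of_one_le le_rfl]

/-- The driving function of real time: `W_t = U_{σ(t)}`. [folklore] -/
def drivingR (h : SlitArcData A γ) (t : ℝ) : ℝ := h.tipFn (h.sigmaR t)

/-- `W (t.toNNReal) = W_t` for `t ≥ 0`. [folklore] -/
theorem driving_toNNReal (h : SlitArcData A γ) {t : ℝ} (ht : 0 ≤ t) : h.driving t.toNNReal = h.drivingR t := by
  simp [driving, drivingR, Real.coe_toNNReal t ht]

/-- `W` of real time is continuous. [folklore] -/
theorem continuous_drivingR (h : SlitArcData A γ) : Continuous h.drivingR :=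
  h.tipFn_continuousOn.comp_continuous h.continuous_sigmaR fun _ ↦ h.sigmaR_mem _

/-- `W_t = U_{σ(t)}` at positive times before `S`. [folklore] -/
theorem drivingR_of_mem (h : SlitArcData A γ) {t : ℝ} (ht : t ∈ Ioo 0 h.termTimeR) :
    h.drivingR t = h.tipVal (h.sigmaR_mem_Ioo ht) := by
  rw [drivingR, h.tipFn_of_mem (h.sigmaR_mem_Ioo ht)]

/-- `W_0 = γ(0)` (real time). [folklore] -/
theorem drivingR_of_nonpos (h : SlitArcData A γ) {t : ℝ} (ht : t ≤ 0) : h.drivingR t = (γ 0).re := by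
  rw [drivingR, h.sigmaR_of_nonpos ht, tipFn_zero]

/-- `|Im w| ≤ ‖w - x‖` for real `x`. [folklore] -/
theorem abs_im_le_norm_sub_ofReal (w : ℂ) (x : ℝ) : |w.im| ≤ ‖w - x‖ := by
  have := abs_im_le_norm (w - x)
  simpa using this

section Orbit

variable {z : ℂ} {S' : ℝ}

/-- The orbit stays in `ℍ` on `[0, S')` as long as `z` is off the slits. [folklore] -/
theorem orbit_mem (h : SlitArcData A γ) (hz : z ∈ upperHalfPlaneSet) (hS' : S' ≤ h.termTimeR)
    (hoff : ∀ t ∈ Ioo 0 S', z ∉ slit γ (h.sigmaR t)) {t : ℝ} (ht : t ∈ Ico 0 S') :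
    h.orbit z t ∈ upperHalfPlaneSet := by
  rcases ht.1.lt_or_eq with ht0 | ht0
  · have htm : t ∈ Ioo 0 h.termTimeR := ⟨ht0, ht.2.trans_le hS'⟩
    rw [h.orbit_of_mem z htm]
    exact (h.slitMap _).mapsTo ⟨hz, hoff t ⟨ht0, ht.2⟩⟩
  · rw [← ht0, h.orbit_of_nonpos z le_rfl]; exact hz

/-- `‖g_{σ(t)}(z) - W_t‖ ≥ Im g_{σ(t)}(z) > 0`. [folklore] -/
theorem im_orbit_le_norm_sub (h : SlitArcData A γ) (z : ℂ) (t : ℝ) :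
    (h.orbit z t).im ≤ ‖h.orbit z t - h.drivingR t‖ :=
  (le_abs_self _).trans (abs_im_le_norm_sub_ofReal _ _)

/-- **Right difference quotients** (Lawler (2005), proof of Prop. 4.4 via Prop. 3.46): for
`t ∈ [0, S')` and every `ε > 0`,
`‖g_{σ(s)}(z) - g_{σ(t)}(z) - (s - t) · 2/(g_{σ(t)}(z) - W_t)‖ ≤ ε (s - t)` for `s ↓ t`.
[cite: Lawler2005, §4.1 Prop. 4.4 (proof)] -/
theorem orbit_expansion (h : SlitArcData A γ) (hz : z ∈ upperHalfPlaneSet) (hS' : S' ≤ h.termTimeR)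
    (hoff : ∀ t ∈ Ioo 0 S', z ∉ slit γ (h.sigmaR t)) {t : ℝ} (ht : t ∈ Ico 0 S') {ε : ℝ} (hε : 0 < ε) :
    ∀ᶠ s in 𝓝[>] t, ‖h.orbit z s - h.orbit z t - (s - t) * (2 / (h.orbit z t - h.drivingR t))‖ ≤ ε * (s - t) := by
  set w := h.orbit z t with hw
  set x := h.drivingR t with hx
  have hwH : w ∈ upperHalfPlaneSet := h.orbit_mem hz hS' hoff ht
  have hm : 0 < ‖w - x‖ := lt_of_lt_of_le hwH (h.im_orbit_le_norm_sub z t)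
  set ε₁ : ℝ := min (‖w - x‖ / 2) (ε * ‖w - x‖ ^ 2 / 12) with hε₁
  have hε₁0 : 0 < ε₁ := lt_min (by positivity) (by positivity)
  have hε₁m : 2 * ε₁ ≤ ‖w - x‖ := by linarith [min_le_left (‖w - x‖ / 2) (ε * ‖w - x‖ ^ 2 / 12)]
  have hε₁e : 12 * ε₁ / ‖w - x‖ ^ 2 ≤ ε := by
    rw [div_le_iff₀ (by positivity)]
    linarith [min_le_right (‖w - x‖ / 2) (ε * ‖w - x‖ ^ 2 / 12)]
  -- continuity of `σ` at `t` from the right, and `s < S'`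
  have hσ : Tendsto h.sigmaR (𝓝[>] t) (𝓝 (h.sigmaR t)) :=
    (h.continuous_sigmaR.tendsto t).mono_left nhdsWithin_le_nhds
  have hsS' : ∀ᶠ s in 𝓝[>] t, s < S' := by
    filter_upwards [mem_nhdsWithin_of_mem_nhds (Iio_mem_nhds ht.2)] with s hs; exact hs
  rcases ht.1.lt_or_eq with ht0 | ht0
  · -- `t > 0`: quotient map `g_{u,u'}` with `u = σ t`, `u' = σ s`
    have htm : t ∈ Ioo 0 h.termTimeR := ⟨ht0, ht.2.trans_le hS'⟩
    have hu : h.sigmaR t ∈ Ioo (0 : ℝ) 1 := h.sigmaR_mem_Ioo htm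
    obtain ⟨θ, hθ, hK⟩ := h.exists_diffImage_subset_closedBall_tipVal hε₁0
    have hσθ : ∀ᶠ s in 𝓝[>] t, h.sigmaR s - h.sigmaR t < θ := by
      have := hσ (Iio_mem_nhds (show h.sigmaR t < h.sigmaR t + θ by linarith))
      filter_upwards [this] with s hs
      have : h.sigmaR s < h.sigmaR t + θ := hs
      linarith
    filter_upwards [hσθ, hsS', self_mem_nhdsWithin] with s hsθ hsS hst
    have hst' : t < s := hst
    have hsm : s ∈ Ioo 0 h.termTimeR := ⟨ht0.trans hst', hsS.trans_le hS'⟩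
    have hu' : h.sigmaR s ∈ Ioo (0 : ℝ) 1 := h.sigmaR_mem_Ioo hsm
    have huu' : h.sigmaR t ≤ h.sigmaR s :=
      h.sigmaR_strictMonoOn.monotoneOn ⟨htm.1.le, htm.2.le⟩ ⟨hsm.1.le, hsm.2.le⟩ hst'.le
    have hzs : z ∈ upperHalfPlaneSet \ slit γ (h.sigmaR s) := ⟨hz, hoff s ⟨hsm.1, hsS⟩⟩
    have h12 := diff_slit_subset γ huu'
    have hzt : z ∈ upperHalfPlaneSet \ slit γ (h.sigmaR t) := h12 hzs
    have h₁ := h.isHydrodynamicMap_slitMap hu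
    have h₂ := h.isHydrodynamicMap_slitMap hu'
    have hb₁ := h.isBounded_slit_inter hu.2
    have hb₂ := h.isBounded_slit_inter hu'.2
    have hψ := h₁.diffQuotient h₂ hb₁ h12
    have hadd := h₁.hcap_diffQuotient h₂ hb₁ hb₂ h12
    have hKx : diffImage (h.slitMap hu) (slit γ (h.sigmaR s)) ∩ upperHalfPlaneSet ⊆
        closedBall ((h.tipVal hu : ℝ) : ℂ) ε₁ := inter_subset_left.trans (hK hu hu' huu' hsθ)
    -- the capacity of the quotient map is `2(s - t)`
    have hcap2 : hcap (diffImage (h.slitMap hu) (slit γ (h.sigmaR s)))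
        (RandomPlanarGeometry.diffQuotient (h.slitMap hu) (h.slitMap hu') h12) = 2 * (s - t) := by
      rw [hadd, ← h.capFn_of_mem hu', ← h.capFn_of_mem hu, h.capFn_sigmaR ⟨hsm.1.le, hsm.2.le⟩,
        h.capFn_sigmaR ⟨htm.1.le, htm.2.le⟩]; ring
    -- identify `w`, `x`, `y s`
    have hwt : w = h.slitMap hu z := by rw [hw, h.orbit_of_mem z htm]
    have hxt : x = h.tipVal hu := by rw [hx, h.drivingR_of_mem htm]
    have hys : h.orbit z s = RandomPlanarGeometry.diffQuotient (h.slitMap hu) (h.slitMap hu') h12 w := by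
      rw [h.orbit_of_mem z hsm, hwt, diffQuotient_apply_apply h12 hzs]
    have hwH' : w ∈ upperHalfPlaneSet := hwH
    have key := hψ.norm_sub_sub_div_le hKx hε₁0 hwH' (by rw [← hxt]; exact hε₁m)
    rw [hcap2, ← hxt, ← hys] at key
    have heq : h.orbit z s - w - (s - t) * (2 / (w - x)) = h.orbit z s - w - ((2 * (s - t) : ℝ) : ℂ) / (w - x) := by
      push_cast; ring
    rw [heq]
    refine key.trans ?_
    have hst0 : 0 ≤ s - t := by linarith
    calc 6 * (2 * (s - t)) * ε₁ / ‖w - x‖ ^ 2 = (12 * ε₁ / ‖w - x‖ ^ 2) * (s - t) := by ring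
      _ ≤ ε * (s - t) := mul_le_mul_of_nonneg_right hε₁e hst0
  · -- `t = 0`: the map `g_{u'}` itself, `u' = σ s`
    subst ht0
    obtain ⟨θ, hθ, hsmall⟩ := h.exists_slit_inter_subset_closedBall hε₁0
    have hσθ : ∀ᶠ s in 𝓝[>] (0 : ℝ), h.sigmaR s < θ := by
      have := hσ (Iio_mem_nhds (show h.sigmaR 0 < θ by rw [sigmaR_zero]; exact hθ))
      filter_upwards [this] with s hs; exact hs
    filter_upwards [hσθ, hsS', self_mem_nhdsWithin] with s hsθ hsS hs0
    have hs0' : 0 < s := hs0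
    have hsm : s ∈ Ioo 0 h.termTimeR := ⟨hs0', hsS.trans_le hS'⟩
    have hu' : h.sigmaR s ∈ Ioo (0 : ℝ) 1 := h.sigmaR_mem_Ioo hsm
    have hzs : z ∈ upperHalfPlaneSet \ slit γ (h.sigmaR s) := ⟨hz, hoff s ⟨hsm.1, hsS⟩⟩
    have hK := (hsmall hu' hsθ).1
    have h₂ := h.isHydrodynamicMap_slitMap hu'
    have hcap2 : hcap (slit γ (h.sigmaR s)) (h.slitMap hu') = 2 * s := by
      rw [← h.capFn_of_mem hu', h.capFn_sigmaR ⟨hsm.1.le, hsm.2.le⟩]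
    have hw0 : w = z := by rw [hw, h.orbit_of_nonpos z le_rfl]
    have hx0 : x = (γ 0).re := by rw [hx, h.drivingR_of_nonpos le_rfl]
    have hys : h.orbit z s = h.slitMap hu' z := h.orbit_of_mem z hsm
    have key := h₂.norm_sub_sub_div_le hK hε₁0 hz (by rw [← hx0, ← hw0]; exact hε₁m)
    rw [hcap2, ← hx0, ← hys] at key
    rw [hw0]
    have heq : h.orbit z s - z - ((s : ℂ) - ((0 : ℝ) : ℂ)) * (2 / (z - x)) =
        h.orbit z s - z - ((2 * s : ℝ) : ℂ) / (z - x) := by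
      push_cast; ring
    rw [heq]
    refine key.trans ?_
    rw [hw0] at hε₁e
    calc 6 * (2 * s) * ε₁ / ‖z - x‖ ^ 2 = (12 * ε₁ / ‖z - x‖ ^ 2) * (s - 0) := by ring
      _ ≤ ε * (s - 0) := mul_le_mul_of_nonneg_right hε₁e (by linarith)

/-- **Right derivative of the orbit**: `2/(g_{σ(t)}(z) - W_t)` at every `t ∈ [0, S')`. [cite: Lawler2005, §4.1 Prop. 4.4] -/
theorem orbit_hasDerivWithinAt_Ici (h : SlitArcData A γ) (hz : z ∈ upperHalfPlaneSet) (hS' : S' ≤ h.termTimeR)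
    (hoff : ∀ t ∈ Ioo 0 S', z ∉ slit γ (h.sigmaR t)) {t : ℝ} (ht : t ∈ Ico 0 S') :
    HasDerivWithinAt (h.orbit z) (2 / (h.orbit z t - h.drivingR t)) (Ici t) t := by
  rw [← hasDerivWithinAt_Ioi_iff_Ici, hasDerivWithinAt_iff_tendsto, Metric.tendsto_nhds]
  intro ε hε
  filter_upwards [h.orbit_expansion hz hS' hoff ht (half_pos hε), self_mem_nhdsWithin] with s hs hst
  have hst' : 0 < s - t := by have : t < s := hst; linarith
  have h1 : ‖s - t‖ = s - t := by rw [Real.norm_eq_abs, abs_of_pos hst']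
  have h2 : (s - t) • (2 / (h.orbit z t - h.drivingR t)) = ((s : ℂ) - t) * (2 / (h.orbit z t - h.drivingR t)) := by
    rw [Complex.real_smul, ofReal_sub]
  rw [dist_zero_right, Real.norm_eq_abs, abs_of_nonneg (by positivity), h1, h2]
  calc (s - t)⁻¹ * ‖h.orbit z s - h.orbit z t - ((s : ℂ) - t) * (2 / (h.orbit z t - h.drivingR t))‖
      ≤ (s - t)⁻¹ * (ε / 2 * (s - t)) := by gcongr
    _ = ε / 2 := by field_simp
    _ < ε := half_lt_self hε

/-- **Continuity of the orbit on `[0, S')`.** [folklore] -/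
theorem orbit_continuousOn (h : SlitArcData A γ) (hz : z ∈ upperHalfPlaneSet) (hS' : S' ≤ h.termTimeR)
    (hoff : ∀ t ∈ Ioo 0 S', z ∉ slit γ (h.sigmaR t)) : ContinuousOn (h.orbit z) (Ico 0 S') := by
  intro t ht
  rw [Metric.continuousWithinAt_iff]
  intro ε hε
  have hσc : ContinuousAt h.sigmaR t := h.continuous_sigmaR.continuousAt
  rcases ht.1.lt_or_eq with ht0 | ht0
  · have htm : t ∈ Ioo 0 h.termTimeR := ⟨ht0, ht.2.trans_le hS'⟩
    have hu : h.sigmaR t ∈ Ioo (0 : ℝ) 1 := h.sigmaR_mem_Ioo htm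
    obtain ⟨θ, hθ, hB⟩ := h.norm_slitMap_sub_slitMap_le (half_pos hε)
    obtain ⟨δ₁, hδ₁, hσδ⟩ := Metric.continuousAt_iff.1 hσc θ hθ
    refine ⟨min δ₁ t, lt_min hδ₁ ht0, fun s hs hdist ↦ ?_⟩
    have hs0 : 0 < s := by
      rw [Real.dist_eq] at hdist
      have := (abs_lt.1 (hdist.trans_le (min_le_right _ _))).1; linarith
    have hsm : s ∈ Ioo 0 h.termTimeR := ⟨hs0, hs.2.trans_le hS'⟩
    have hu' : h.sigmaR s ∈ Ioo (0 : ℝ) 1 := h.sigmaR_mem_Ioo hsm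
    have hσd : |h.sigmaR s - h.sigmaR t| < θ := by
      have := hσδ (hdist.trans_le (min_le_left _ _)); rwa [Real.dist_eq] at this
    rw [h.orbit_of_mem z hsm, h.orbit_of_mem z htm, dist_eq_norm]
    rcases le_total (h.sigmaR t) (h.sigmaR s) with hle | hle
    · have := hB hu hu' hle (by linarith [(abs_lt.1 hσd).2]) z ⟨hz, hoff s ⟨hs0, hs.2⟩⟩
      linarith
    · have := hB hu' hu hle (by linarith [(abs_lt.1 hσd).1]) z ⟨hz, hoff t ⟨ht0, ht.2⟩⟩
      rw [norm_sub_rev]; linarith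
  · subst ht0
    obtain ⟨θ, hθ, hsmall⟩ := h.exists_slit_inter_subset_closedBall (by positivity : 0 < ε / 1000)
    obtain ⟨δ₁, hδ₁, hσδ⟩ := Metric.continuousAt_iff.1 hσc θ hθ
    refine ⟨δ₁, hδ₁, fun s hs hdist ↦ ?_⟩
    rw [h.orbit_of_nonpos z le_rfl]
    rcases hs.1.lt_or_eq with hs0 | hs0
    · have hsm : s ∈ Ioo 0 h.termTimeR := ⟨hs0, hs.2.trans_le hS'⟩
      have hu' : h.sigmaR s ∈ Ioo (0 : ℝ) 1 := h.sigmaR_mem_Ioo hsm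
      have hσd : h.sigmaR s < θ := by
        have := hσδ hdist; rw [Real.dist_eq, sigmaR_zero, sub_zero] at this
        exact (le_abs_self _).trans_lt this
      have hK := (hsmall hu' hσd).1
      rw [h.orbit_of_mem z hsm, dist_eq_norm]
      have := (h.isHydrodynamicMap_slitMap hu').norm_sub_self_le hK (by positivity) ⟨hz, hoff s ⟨hs0, hs.2⟩⟩
      linarith
    · rw [← hs0, h.orbit_of_nonpos z le_rfl, dist_self]; exact hε

/-- **Continuity of the orbit at the terminal time** for `z ∈ ℍ ∖ A` (`g_{σ(t)} → g_A`). [cite: LawlerSchrammWerner2003Restriction, proof of Lemma 3.5 (p. 13, Φ_s = Φ_{E_δ})] -/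
theorem orbit_continuousOn_Icc (h : SlitArcData A γ) (hz : z ∈ upperHalfPlaneSet \ A) :
    ContinuousOn (h.orbit z) (Icc 0 h.termTimeR) := by
  have hoff : ∀ t ∈ Ioo 0 h.termTimeR, z ∉ slit γ (h.sigmaR t) := fun t ht ↦
    (h.diff_subset_diff_slit (h.sigmaR_mem_Ioo ht).2 hz).2
  intro t ht
  rcases ht.2.lt_or_eq with htS | htS
  · refine ((h.orbit_continuousOn hz.1 le_rfl hoff) t ⟨ht.1, htS⟩).mono_of_mem_nhdsWithin ?_
    exact mem_of_superset (inter_mem_nhdsWithin (Icc 0 h.termTimeR) (Iio_mem_nhds htS))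
      fun s hs ↦ ⟨hs.1.1, hs.2⟩
  · subst htS
    rw [Metric.continuousWithinAt_iff]
    intro ε hε
    obtain ⟨θ, hθ, hB⟩ := h.norm_hydroMapA_sub_slitMap_le (half_pos hε)
    obtain ⟨δ₁, hδ₁, hσδ⟩ := Metric.continuousAt_iff.1 h.continuous_sigmaR.continuousAt θ hθ
    refine ⟨min δ₁ h.termTimeR, lt_min hδ₁ h.termTimeR_pos, fun s hs hdist ↦ ?_⟩
    rw [h.orbit_of_le z le_rfl]
    rcases hs.2.lt_or_eq with hsS | hsS
    · have hs0 : 0 < s := by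
        rw [Real.dist_eq] at hdist
        have := (abs_lt.1 (hdist.trans_le (min_le_right _ _))).1; linarith
      have hsm : s ∈ Ioo 0 h.termTimeR := ⟨hs0, hsS⟩
      have hu' : h.sigmaR s ∈ Ioo (0 : ℝ) 1 := h.sigmaR_mem_Ioo hsm
      have hσd : 1 - h.sigmaR s < θ := by
        have := hσδ (hdist.trans_le (min_le_left _ _))
        rw [Real.dist_eq, sigmaR_termTimeR] at this
        linarith [(abs_lt.1 this).1]
      rw [h.orbit_of_mem z hsm, dist_eq_norm, norm_sub_rev]
      have := hB hu' hσd z hz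
      linarith
    · rw [hsS, h.orbit_of_le z le_rfl, dist_self]; exact hε

end Orbit

/-! ### Loewner's equation for the orbits (Lawler (2005), Prop. 4.4) -/

section Solution

variable {z : ℂ} {S' : ℝ}

/-- The Loewner field along the orbit is continuous on `[0, S')`. [folklore] -/
theorem continuousOn_field (h : SlitArcData A γ) (hz : z ∈ upperHalfPlaneSet) (hS' : S' ≤ h.termTimeR)
    (hoff : ∀ t ∈ Ioo 0 S', z ∉ slit γ (h.sigmaR t)) :
    ContinuousOn (fun t ↦ (2 : ℂ) / (h.orbit z t - h.drivingR t)) (Ico 0 S') := by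
  refine continuousOn_const.div ((h.orbit_continuousOn hz hS' hoff).sub
    (continuous_ofReal.comp h.continuous_drivingR).continuousOn) fun t ht h0 ↦ ?_
  have him : 0 < (h.orbit z t).im := h.orbit_mem hz hS' hoff ht
  have := h.im_orbit_le_norm_sub z t
  rw [h0, norm_zero] at this
  linarith

/-- **The orbit is differentiable on `[0, S')` with derivative `2/(g_{σ(t)}(z) - W_t)`** (Lawler
(2005), Lemma 4.3: a continuous function with continuous right derivative is `C¹` — here by
comparison with `z + ∫₀ᵗ 2/(g_{σ(s)}(z) - W_s) ds`, Mathlib's `eq_of_has_deriv_right_eq`).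
[cite: Lawler2005, §4.1 Lemma 4.3, Prop. 4.4] -/
theorem orbit_hasDerivWithinAt (h : SlitArcData A γ) (hz : z ∈ upperHalfPlaneSet) (hS' : S' ≤ h.termTimeR)
    (hoff : ∀ t ∈ Ioo 0 S', z ∉ slit γ (h.sigmaR t)) {t : ℝ} (ht : t ∈ Ico 0 S') :
    HasDerivWithinAt (h.orbit z) (2 / (h.orbit z t - h.drivingR t)) (Ico 0 S') t := by
  set F : ℝ → ℂ := fun s ↦ 2 / (h.orbit z s - h.drivingR s) with hF
  set b : ℝ := (t + S') / 2 with hb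
  have htb : t < b := by rw [hb]; linarith [ht.2]
  have hbS : b < S' := by rw [hb]; linarith [ht.2]
  have h0b : (0 : ℝ) ≤ b := ht.1.trans htb.le
  set Ft : ℝ → ℂ := fun s ↦ F (projIcc 0 b h0b s) with hFt
  have hFc : ContinuousOn F (Icc 0 b) := (h.continuousOn_field hz hS' hoff).mono (Icc_subset_Ico_right hbS)
  have hFtc : Continuous Ft :=
    hFc.comp_continuous (continuous_subtype_val.comp continuous_projIcc) fun s ↦ (projIcc 0 b h0b s).2
  have hFt_eq : ∀ s ∈ Icc 0 b, Ft s = F s := fun s hs ↦ by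
    simp only [hFt, projIcc_of_mem h0b hs]
  set Y : ℝ → ℂ := fun s ↦ z + ∫ x in (0 : ℝ)..s, Ft x with hY
  have hYd : ∀ s, HasDerivAt Y (Ft s) s := fun s ↦ by
    have := (hFtc.integral_hasStrictDerivAt 0 s).hasDerivAt
    exact this.const_add z
  have heq : ∀ s ∈ Icc 0 b, h.orbit z s = Y s := by
    refine eq_of_has_deriv_right_eq (f' := Ft) (fun s hs ↦ ?_) (fun s _ ↦ (hYd s).hasDerivWithinAt) ?_ ?_ ?_
    · rw [hFt_eq s ⟨hs.1, hs.2.le⟩]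
      exact h.orbit_hasDerivWithinAt_Ici hz hS' hoff ⟨hs.1, hs.2.trans hbS⟩
    · exact (h.orbit_continuousOn hz hS' hoff).mono (Icc_subset_Ico_right hbS)
    · exact fun s _ ↦ (hYd s).continuousAt.continuousWithinAt
    · simp [hY, h.orbit_of_nonpos z le_rfl]
  have hYt : HasDerivWithinAt Y (F t) (Ico 0 S') t := by
    rw [← hFt_eq t ⟨ht.1, htb.le⟩]; exact (hYd t).hasDerivWithinAt
  refine hYt.congr_of_eventuallyEq ?_ (heq t ⟨ht.1, htb.le⟩)
  filter_upwards [mem_nhdsWithin_of_mem_nhds (Iio_mem_nhds htb), self_mem_nhdsWithin] with s hs hsD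
  exact heq s ⟨hsD.1, le_of_lt hs⟩

/-- The time domain `{0 ≤ t, t < S'}` of the tree's `Loewner.IsSolution`. [folklore] -/
theorem setOf_toNNReal_lt_eq {S' : ℝ} (hS'0 : 0 < S') :
    {t : ℝ | 0 ≤ t ∧ (t.toNNReal : WithTop ℝ≥0) < ((S'.toNNReal : ℝ≥0) : WithTop ℝ≥0)} = Ico 0 S' := by
  ext t
  simp only [mem_setOf_eq, mem_Ico, WithTop.coe_lt_coe, Real.toNNReal_lt_toNNReal_iff hS'0]

/-- **Loewner's equation** (Lawler (2005), Prop. 4.4; [LSW] p. 13 "`∂_t g_t(z) = 2/(g_t(z) - U_t)`"):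
for `z ∈ ℍ` off the slits `γ[0, σ(t)]`, `0 < t < S'`, the orbit `t ↦ g_{σ(t)}(z)` is a solution
of the tree's chordal Loewner equation driven by `W` on `[0, S')`.
[cite: Lawler2005, §4.1 Prop. 4.4] -/
theorem isSolution_orbit (h : SlitArcData A γ) (hz : z ∈ upperHalfPlaneSet) (hS'0 : 0 < S')
    (hS' : S' ≤ h.termTimeR) (hoff : ∀ t ∈ Ioo 0 S', z ∉ slit γ (h.sigmaR t)) :
    Loewner.IsSolution h.driving z (h.orbit z) ((S'.toNNReal : ℝ≥0) : WithTop ℝ≥0) := by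
  refine ⟨h.orbit_of_nonpos z le_rfl, fun t ht ↦ ?_, fun t ht htS ↦ ?_⟩
  · rw [setOf_toNNReal_lt_eq hS'0] at ht ⊢
    rw [Loewner.vectorField_apply, h.driving_toNNReal ht.1]
    exact h.orbit_hasDerivWithinAt hz hS' hoff ht
  · have ht' : t < S' := by rwa [WithTop.coe_lt_coe, Real.toNNReal_lt_toNNReal_iff hS'0] at htS
    rw [h.driving_toNNReal ht]
    intro h0
    have him : 0 < (h.orbit z t).im := h.orbit_mem hz hS' hoff ⟨ht, ht'⟩
    have : (h.orbit z t).im = 0 := by rw [h0, ofReal_im]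
    linarith

/-- **The swallowing time of an orbit which meets the driving function at `S'`**: if moreover
`g_{σ(t)}(z) - W_t → 0` as `t ↑ S'`, then `T_z = S'` (uniqueness of solutions,
`Loewner.IsSolution.eqOn_holds`, and the extension criterion). [cite: Lawler2005, §4.1 (T_z is the first time g_t(z) - W_t hits 0)] -/
theorem swallowingTime_eq_of_tendsto (h : SlitArcData A γ) (hz : z ∈ upperHalfPlaneSet) (hS'0 : 0 < S')
    (hS' : S' ≤ h.termTimeR) (hoff : ∀ t ∈ Ioo 0 S', z ∉ slit γ (h.sigmaR t))
    (hlim : Tendsto (fun t ↦ h.orbit z t - h.drivingR t) (𝓝[<] S') (𝓝 0)) :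
    Loewner.swallowingTime h.driving z = ((S'.toNNReal : ℝ≥0) : WithTop ℝ≥0) := by
  have hsol := h.isSolution_orbit hz hS'0 hS' hoff
  apply le_antisymm _ hsol.le_swallowingTime
  refine sSup_le fun T' ⟨g', hg'⟩ ↦ ?_
  by_contra hT
  rw [not_le] at hT
  have heqOn := Loewner.IsSolution.eqOn_holds h.continuous_driving hg' hsol
  -- `g'` is continuous at `S'`
  have hcont : ContinuousAt g' S' := by
    refine (hg'.continuousOn S' ⟨hS'0.le, hT⟩).continuousAt ?_
    rw [setOf_and]
    exact inter_mem (mem_of_superset (Ioi_mem_nhds hS'0) fun t ht ↦ show (0 : ℝ) ≤ t from le_of_lt ht)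
      (Loewner.setOf_toNNReal_lt_mem_nhds hT)
  have hev : ∀ᶠ t in 𝓝[<] S', g' t = h.orbit z t := by
    filter_upwards [Ioo_mem_nhdsLT hS'0] with t ht
    refine heqOn ⟨ht.1.le, lt_min ?_ ?_⟩
    · have : (t.toNNReal : WithTop ℝ≥0) < ((S'.toNNReal : ℝ≥0) : WithTop ℝ≥0) := by
        rw [WithTop.coe_lt_coe, Real.toNNReal_lt_toNNReal_iff hS'0]; exact ht.2
      exact this.trans hT
    · rw [WithTop.coe_lt_coe, Real.toNNReal_lt_toNNReal_iff hS'0]; exact ht.2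
  have h1 : Tendsto (fun t ↦ g' t - h.drivingR t) (𝓝[<] S') (𝓝 (g' S' - h.drivingR S')) :=
    (hcont.tendsto.mono_left nhdsWithin_le_nhds).sub
      (((continuous_ofReal.comp h.continuous_drivingR).tendsto S').mono_left nhdsWithin_le_nhds)
  have h2 : Tendsto (fun t ↦ g' t - h.drivingR t) (𝓝[<] S') (𝓝 0) :=
    hlim.congr' (hev.mono fun t ht ↦ by beta_reduce; rw [ht])
  have huniq := tendsto_nhds_unique h1 h2
  have hne := hg'.ne hS'0.le hT
  rw [h.driving_toNNReal hS'0.le] at hne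
  exact hne (sub_eq_zero.1 huniq)

end Solution

/-! ### The swallowing times (Lawler (2005), Prop. 4.4: "If `z = γ(t₀)`, … `U_{t₀} = lim_{t → t₀-} g_t(z)`") -/

/-- **`Im g_A(z) ≤ Im g_{σ(t)}(z)`** along the orbit of `z ∈ ℍ ∖ A` (`g_A = g_{u,A} ∘ g_u` with
`Im g_{u,A} ≤ Im`). [cite: Lawler2005, §3.4 (3.7)] -/
theorem im_hydroMapA_le_im_orbit (h : SlitArcData A γ) {z : ℂ} (hz : z ∈ upperHalfPlaneSet \ A) {t : ℝ}
    (ht : t ∈ Ico 0 h.termTimeR) : (h.hydroMapA z).im ≤ (h.orbit z t).im := by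
  rcases ht.1.lt_or_eq with ht0 | ht0
  · have htm : t ∈ Ioo 0 h.termTimeR := ⟨ht0, ht.2⟩
    have hu := h.sigmaR_mem_Ioo htm
    rw [h.orbit_of_mem z htm]
    have h12 := h.diff_subset_diff_slit hu.2
    have h₁ := h.isHydrodynamicMap_slitMap hu
    have hb₁ := h.isBounded_slit_inter hu.2
    have hψ := h₁.diffQuotient h.isHydrodynamicMap_hydroMapA hb₁ h12
    have hb := h₁.isBounded_diffImage hb₁ h.isBounded_inter (K₂ := A)
    have := hψ.im_le hb (mapsTo_diff_diffImage h12 hz)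
    rwa [diffQuotient_apply_apply h12 hz] at this
  · rw [← ht0, h.orbit_of_nonpos z le_rfl]
    exact h.isPlusHull.hydroMap_im_le h.nonempty hz

/-- The terminal time as `toNNReal`. [folklore] -/
theorem toNNReal_termTimeR (h : SlitArcData A γ) : h.termTimeR.toNNReal = h.termTime := by
  rw [← coe_termTime, Real.toNNReal_coe]

/-- **Points off the hull are not swallowed by the terminal time: `T_z > S`** (the orbit solves
Loewner's equation on `[0, S]` and stays `Im g_A(z)`-away from the driving function).
[cite: Lawler2005, §4.1 Prop. 4.4 (z ∉ γ(0,∞))] -/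
theorem termTime_lt_swallowingTime (h : SlitArcData A γ) {z : ℂ} (hz : z ∈ upperHalfPlaneSet \ A) :
    (h.termTime : WithTop ℝ≥0) < Loewner.swallowingTime h.driving z := by
  have hoff : ∀ t ∈ Ioo 0 h.termTimeR, z ∉ slit γ (h.sigmaR t) := fun t ht ↦
    (h.diff_subset_diff_slit (h.sigmaR_mem_Ioo ht).2 hz).2
  have hsol := h.isSolution_orbit hz.1 h.termTimeR_pos le_rfl hoff
  rw [h.toNNReal_termTimeR] at hsol
  have him : 0 < (h.hydroMapA z).im := h.hydroMapA.mapsTo hz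
  refine hsol.coe_lt_swallowingTime_of_le_norm_sub h.continuous_driving h.termTime_pos
    (δ := ((h.hydroMapA z).im).toNNReal) (Real.toNNReal_pos.2 him) fun t ht htS ↦ ?_
  rw [h.driving_toNNReal ht, Real.coe_toNNReal _ him.le]
  rw [coe_termTime] at htS
  exact (h.im_hydroMapA_le_im_orbit hz ⟨ht, htS⟩).trans (h.im_orbit_le_norm_sub z t)

/-- The curve `t ↦ γ(σ(t))` is continuous. [folklore] -/
theorem continuous_apply_sigmaR (h : SlitArcData A γ) : Continuous fun t ↦ γ (h.sigmaR t) :=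
  h.continuousOn.comp_continuous h.continuous_sigmaR fun _ ↦ h.sigmaR_mem _

/-- **Points of the arc: `T_{γ(v)} = b(v)/2`** (Prop. 4.4: "`U_{t₀} = lim_{t → t₀-} g_t(z)`" for
`z = γ(t₀)`; here `g_{σ(t)}(γ(v)) - W_t → 0` as `t ↑ b(v)/2` by the uniform tip estimate).
[cite: Lawler2005, §4.1 Prop. 4.4 (z = γ(t₀))] -/
theorem swallowingTime_arc (h : SlitArcData A γ) {v : ℝ} (hv : v ∈ Ioo (0 : ℝ) 1) :
    Loewner.swallowingTime h.driving (γ v) = (((h.capFn v / 2).toNNReal : ℝ≥0) : WithTop ℝ≥0) := by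
  set S' : ℝ := h.capFn v / 2 with hS'def
  have hv1 : v ∈ Icc (0 : ℝ) 1 := ⟨hv.1.le, hv.2.le⟩
  have hbv : 0 < h.capFn v := by rw [h.capFn_of_mem hv]; exact h.hcap_slit_pos hv
  have hS'0 : 0 < S' := by rw [hS'def]; linarith
  have hS' : S' ≤ h.termTimeR := by
    have := (h.capFn_mem_Icc hv1).2; rw [hS'def]; unfold termTimeR; linarith
  have hσS' : h.sigmaR S' = v := h.sigmaR_capFn_div_two hv1
  have hoff : ∀ t ∈ Ioo 0 S', γ v ∉ slit γ (h.sigmaR t) := fun t ht ↦ by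
    have hlt : h.sigmaR t < v := by
      rw [← hσS']
      exact h.sigmaR_strictMonoOn ⟨ht.1.le, ht.2.le.trans hS'⟩ ⟨hS'0.le, hS'⟩ ht.2
    exact (h.apply_mem_diff_slit (h.sigmaR_mem t).1 hlt hv.2).2
  refine h.swallowingTime_eq_of_tendsto (h.im_pos v hv) hS'0 hS' hoff ?_
  rw [Metric.tendsto_nhds]
  intro ε₀ hε₀
  obtain ⟨ε, hε, hB⟩ := h.norm_slitMap_sub_tipVal_le (half_pos hε₀)
  have hγσ : ∀ᶠ t in 𝓝[<] S', ‖γ v - γ (h.sigmaR t)‖ < ε := by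
    have hc := (h.continuous_apply_sigmaR.tendsto S').mono_left (nhdsWithin_le_nhds (s := Iio S'))
    rw [hσS'] at hc
    have := hc (ball_mem_nhds _ hε)
    filter_upwards [this] with t ht
    rw [mem_preimage, mem_ball, dist_eq_norm] at ht
    rwa [norm_sub_rev]
  filter_upwards [hγσ, Ioo_mem_nhdsLT hS'0] with t hγt ht
  have htm : t ∈ Ioo 0 h.termTimeR := ⟨ht.1, ht.2.trans_le hS'⟩
  have hu := h.sigmaR_mem_Ioo htm
  rw [dist_zero_right, h.orbit_of_mem _ htm, h.drivingR_of_mem htm]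
  exact (hB hu ⟨h.im_pos v hv, hoff t ht⟩ hγt).trans_lt (half_lt_self hε₀)

/-- **Enclosed points are swallowed exactly at the terminal time: `T_z = S` for `z ∈ int A`**
(`g_{σ(t)}(z) - W_t → 0` as `t ↑ S` by the collapse of the enclosed region).
[cite: LawlerSchrammWerner2003Restriction, proof of Lemma 3.5 (p. 13, the hull at time s is E_δ)] -/
theorem swallowingTime_interior (h : SlitArcData A γ) {z : ℂ} (hz : z ∈ interior A) :
    Loewner.swallowingTime h.driving z = h.termTime := by
  have hzH : z ∈ upperHalfPlaneSet := h.interior_subset_upperHalfPlaneSet hz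
  have hoff : ∀ t ∈ Ioo 0 h.termTimeR, z ∉ slit γ (h.sigmaR t) := fun t ht hmem ↦ by
    have : z ∈ slit γ (h.sigmaR t) ∩ interior A := ⟨hmem, hz⟩
    rw [h.slit_inter_interior_eq (h.sigmaR_mem_Ioo ht).2] at this
    exact this
  rw [← h.toNNReal_termTimeR]
  refine h.swallowingTime_eq_of_tendsto hzH h.termTimeR_pos le_rfl hoff ?_
  rw [Metric.tendsto_nhds]
  intro ε₀ hε₀
  obtain ⟨θ, hθ, hB⟩ := h.norm_slitMap_sub_tipVal_le_of_mem_interior (half_pos hε₀)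
  have hσ : ∀ᶠ t in 𝓝[<] h.termTimeR, 1 - h.sigmaR t < θ := by
    have hc := (h.continuous_sigmaR.tendsto h.termTimeR).mono_left (nhdsWithin_le_nhds (s := Iio h.termTimeR))
    rw [sigmaR_termTimeR] at hc
    have := hc (Ioi_mem_nhds (show 1 - θ < 1 by linarith))
    filter_upwards [this] with t ht
    have : 1 - θ < h.sigmaR t := ht
    linarith
  filter_upwards [hσ, Ioo_mem_nhdsLT h.termTimeR_pos] with t hσt ht
  have hu := h.sigmaR_mem_Ioo ht
  rw [dist_zero_right, h.orbit_of_mem _ ht, h.drivingR_of_mem ht]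
  exact (hB hu hσt z hz).trans_lt (half_lt_self hε₀)

/-! ### The hulls -/

/-- `σ((0, t]) = (0, σ(t)]` for `t ≤ S`. [folklore] -/
theorem sigma_image_Ioc (h : SlitArcData A γ) {t : ℝ≥0} (ht : t ≤ h.termTime) :
    h.sigma '' Ioc 0 t = Ioc 0 (h.sigmaR t) := by
  have ht' : (t : ℝ) ∈ Icc 0 h.termTimeR := ⟨t.coe_nonneg, ht⟩
  ext v
  constructor
  · rintro ⟨s, hs, rfl⟩
    have hs' : (s : ℝ) ∈ Icc 0 h.termTimeR := ⟨s.coe_nonneg, (NNReal.coe_le_coe.2 hs.2).trans ht⟩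
    refine ⟨?_, ?_⟩
    · have := h.sigmaR_strictMonoOn ⟨le_rfl, h.termTimeR_pos.le⟩ hs' (NNReal.coe_pos.2 hs.1)
      rwa [sigmaR_zero] at this
    · exact h.sigmaR_strictMonoOn.monotoneOn hs' ht' (NNReal.coe_le_coe.2 hs.2)
  · rintro ⟨hv0, hvt⟩
    have hv1 : v ∈ Icc (0 : ℝ) 1 := ⟨hv0.le, hvt.trans (h.sigmaR_mem _).2⟩
    have hbv := h.capFn_mem_Icc hv1
    have hpos : 0 < h.capFn v := by
      have := h.capFn_strictMonoOn ⟨le_rfl, zero_le_one⟩ hv1 hv0; rwa [capFn_zero] at this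
    have hnn : 0 ≤ h.capFn v / 2 := by linarith [hbv.1]
    refine ⟨(h.capFn v / 2).toNNReal, ⟨?_, ?_⟩, ?_⟩
    · exact Real.toNNReal_pos.2 (by linarith)
    · rw [← NNReal.coe_le_coe, Real.coe_toNNReal _ hnn]
      have := h.capFn_strictMonoOn.monotoneOn hv1 (h.sigmaR_mem _) hvt
      rw [h.capFn_sigmaR ht'] at this; linarith
    · show h.sigmaR ((h.capFn v / 2).toNNReal : ℝ) = v
      rw [Real.coe_toNNReal _ hnn]; exact h.sigmaR_capFn_div_two hv1

/-- Trichotomy of the points of `ℍ`: off `A`, on the arc, or enclosed. [folklore] -/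
theorem mem_upperHalfPlaneSet_cases (h : SlitArcData A γ) {z : ℂ} (hz : z ∈ upperHalfPlaneSet) :
    z ∈ upperHalfPlaneSet \ A ∨ (∃ v ∈ Ioo (0 : ℝ) 1, γ v = z) ∨ z ∈ interior A := by
  by_cases hzA : z ∈ A
  · have : z ∈ A ∩ upperHalfPlaneSet := ⟨hzA, hz⟩
    rw [h.inter_upperHalfPlaneSet_eq] at this
    rcases this with ⟨v, hv, rfl⟩ | hint
    · exact Or.inr (Or.inl ⟨v, hv, rfl⟩)
    · exact Or.inr (Or.inr hint)
  · exact Or.inl ⟨hz, hzA⟩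

/-- **The hulls before the terminal time: `K_t = γ(0, σ(t)] = γ(σ(0, t])`** (`t < S`).
[cite: Lawler2005, §4.1 Prop. 4.4, Remark 4.5 (the hulls of the chain of a simple curve are γ(0,t])] -/
theorem hull_driving_of_lt (h : SlitArcData A γ) {t : ℝ≥0} (ht : t < h.termTime) :
    Loewner.hull h.driving t = γ '' (h.sigma '' Ioc 0 t) := by
  rw [h.sigma_image_Ioc ht.le]
  have htR : (t : ℝ) < h.termTimeR := ht
  have ht' : (t : ℝ) ∈ Icc 0 h.termTimeR := ⟨t.coe_nonneg, htR.le⟩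
  have hσ1 : h.sigmaR t < 1 := h.sigmaR_lt_one t.coe_nonneg htR
  ext z
  simp only [Loewner.hull, mem_setOf_eq]
  constructor
  · rintro ⟨hzH, hT⟩
    rcases h.mem_upperHalfPlaneSet_cases hzH with hzA | ⟨v, hv, rfl⟩ | hint
    · exfalso
      have := (h.termTime_lt_swallowingTime hzA).trans_le hT
      exact lt_irrefl _ ((WithTop.coe_lt_coe.1 this).trans ht)
    · refine ⟨v, ⟨hv.1, ?_⟩, rfl⟩
      rw [h.swallowingTime_arc hv, WithTop.coe_le_coe, Real.toNNReal_le_iff_le_coe] at hT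
      have hle : h.capFn v ≤ h.capFn (h.sigmaR t) := by rw [h.capFn_sigmaR ht']; linarith
      exact (h.capFn_strictMonoOn.le_iff_le ⟨hv.1.le, hv.2.le⟩ (h.sigmaR_mem _)).1 hle
    · exfalso
      rw [h.swallowingTime_interior hint, WithTop.coe_le_coe] at hT
      exact lt_irrefl _ (ht.trans_le hT)
  · rintro ⟨v, hv, rfl⟩
    have hv' : v ∈ Ioo (0 : ℝ) 1 := ⟨hv.1, hv.2.trans_lt hσ1⟩
    refine ⟨h.im_pos v hv', ?_⟩
    rw [h.swallowingTime_arc hv', WithTop.coe_le_coe, Real.toNNReal_le_iff_le_coe]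
    have := h.capFn_strictMonoOn.monotoneOn ⟨hv'.1.le, hv'.2.le⟩ (h.sigmaR_mem _) hv.2
    rw [h.capFn_sigmaR ht'] at this
    linarith

/-- **The hull at the terminal time is `A ∩ ℍ`** ([LSW] p. 13: the Loewner chain of the
boundary path `β` of `E_δ` ends with the hull `E_δ`). [cite: LawlerSchrammWerner2003Restriction, proof of Lemma 3.5 (p. 13)] -/
theorem hull_driving_termTime (h : SlitArcData A γ) :
    Loewner.hull h.driving h.termTime = A ∩ upperHalfPlaneSet := by
  ext z
  simp only [Loewner.hull, mem_setOf_eq]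
  constructor
  · rintro ⟨hzH, hT⟩
    refine ⟨?_, hzH⟩
    by_contra hzA
    exact lt_irrefl _ ((h.termTime_lt_swallowingTime ⟨hzH, hzA⟩).trans_le hT)
  · rintro ⟨hzA, hzH⟩
    refine ⟨hzH, ?_⟩
    rcases h.mem_upperHalfPlaneSet_cases hzH with hzA' | ⟨v, hv, rfl⟩ | hint
    · exact absurd hzA hzA'.2
    · rw [h.swallowingTime_arc hv, WithTop.coe_le_coe, Real.toNNReal_le_iff_le_coe, coe_termTime]
      have := (h.capFn_mem_Icc ⟨hv.1.le, hv.2.le⟩).2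
      unfold termTimeR; linarith
    · rw [h.swallowingTime_interior hint]

end SlitArcData

/-! ### The named fact and [LSW] Lemma 3.5 -/

/-- **Loewner's slit theorem for the boundary path of an arc hull** — the named fact
`Literature.Probability.RandomPlanarGeometry.IsArcHull.exists_loewner_chain` of
`RestrictionDensityLoewner` ([LSW] proof of Lemma 3.5, p. 13: "By the chordal version of
Loewner's theorem …"; Lawler (2005), Prop. 4.4, Remark 4.5), PROVED: with
`h : SlitArcData A γ` the witnesses are `W = h.driving`, `S = h.termTime = hcap(A)/2`,
`σ = h.sigma = b⁻¹(2·)`. [cite: LawlerSchrammWerner2003Restriction, proof of Lemma 3.5 (p. 13)] -/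
theorem IsArcHull.exists_loewner_chain_holds : IsArcHull.exists_loewner_chain := by
  intro A _ hA γ hγc hγi h0 h1 hpos hfr
  have h : SlitArcData A γ := ⟨hA, hγc, hγi, h0, h1, hpos, hfr⟩
  refine ⟨h.driving, h.termTime, h.sigma, h.continuous_driving, h.termTime_pos, h.driving_zero,
    (h.continuous_sigmaR.comp NNReal.continuous_coe).continuousOn, ?_, ?_, ?_,
    fun t ht ↦ h.hull_driving_of_lt ht, h.hull_driving_termTime⟩
  · intro s hs t ht hst
    exact h.sigmaR_strictMonoOn ⟨s.coe_nonneg, hs⟩ ⟨t.coe_nonneg, ht⟩ (NNReal.coe_lt_coe.2 hst)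
  · exact h.sigmaR_zero
  · exact h.sigmaR_termTimeR

/-- **[LSW] Lemma 3.5, density of `𝒜₀` in `𝒬₊`** — the named fact
`Literature.Probability.RandomPlanarGeometry.IsPlusHull.exists_isLSWGenerated_lswConverges` of
`RestrictionDensity`, now a THEOREM: `RestrictionDensityArc` (reduction to arc hulls),
`LoewnerEulerScheme`/`RestrictionDensityLoewner` (Euler scheme for the normalized Loewner flow,
reduction to Loewner's slit theorem) and the present slit theorem.
[cite: LawlerSchrammWerner2003Restriction, Lemma 3.5 (pp. 12–13)] -/
theorem IsPlusHull.exists_isLSWGenerated_lswConverges_holds :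
    IsPlusHull.exists_isLSWGenerated_lswConverges :=
  IsPlusHull.exists_isLSWGenerated_lswConverges_of_loewner IsArcHull.exists_loewner_chain_holds

end Literature.Probability.RandomPlanarGeometry
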